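import Literature.MathematicalPhysics.KineticTheory.HardSphereMildBBGKYWeak
import Literature.MathematicalPhysics.KineticTheory.HardSphereMildBBGKYFlux
import Literature.MathematicalPhysics.KineticTheory.HardSphereMildBBGKYMarginal
import Literature.MathematicalPhysics.KineticTheory.HardSphereBBGKYLiouvilleEstimate
import HarnessLib

/-!
# Towards the one-step mild BBGKY hierarchy almost everywhere: identification of the flux term
(Cercignani–Illner–Pulvirenti 1994 §4.3, Thm 4.3.1; trunk T-KINETIC, topic
MathematicalPhysics/KineticTheory; continuation of `HardSphereMildBBGKYWeak`.)

The flux side of `weak_identity_untruncated` is identified with the BBGKY collision term of the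
`(k+1)`-particle marginal of the transported density `fden τ = 1_{good} · W ∘ Φ_{-τ}`:

* `fden_comp_perm` — `fden τ` is symmetric in the labels when `W` is (the good set is permutation
  invariant and the regularised flow commutes with relabelling);
* `indicator_body_eq`, `taggedBlock_update` — the flux integrand in the variables of
  `flux_bracket_eq_integral_mul_hsCollisionTerm`;
* `integral_collisionCoords_eq_integral_time` — Fubini, collision time outermost;
* `inner_flux_eq` — at fixed collision time, the flux integral over the collision coordinates
  equals `ε^{d-1} ∫ ψ(Y) hsCollisionTerm (k+m') i' (fden τ ∘ outRep) (Y) dY`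
  (`flux_bracket_eq_integral_mul_hsCollisionTerm`);
* `integral_hsCollisionTerm_append_eq` — marginalising the untagged spectators turns
  `hsCollisionTerm (k+m') i' (fden τ ∘ outRep)` into `hsCollisionTerm k i (f_{k+1} ∘ outRep)` with
  `f_{k+1} = nthMarginal (k+1+m') (k+1) fden τ` (`nthMarginal_appendParticle_eq_of_restSymmetric`).

## References

* C. Cercignani, R. Illner, M. Pulvirenti, *The Mathematical Theory of Dilute Gases*, Springer
  (1994), §4.3.
-/

open MeasureTheory MeasureTheory.Measure Metric Real Set Filter Function Topology
open scoped ENNReal InnerProductSpace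
open Literature.Analysis.FluidPDE Literature.Analysis

namespace Literature.MathematicalPhysics.KineticTheory

noncomputable section

section Kinetic

variable {d : Type*} [Fintype d]

section Pointwise

variable {ε : ℝ} (hε : 0 < ε) (hε' : ε < 2⁻¹)

include hε hε' in
/-- **The transported density `1_{good} · W ∘ Φ_{-τ}` is symmetric in the labels** when `W` is:
`good` is permutation invariant (`comp_perm_mem_good_iff`) and `Φ` commutes with relabelling
(`regFlow_comp_perm`). [folklore] -/
theorem fden_comp_perm {N : ℕ} {W : Config N d (UnitAddTorus d) → ℝ} (σ : Equiv.Perm (Fin N))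
    (hWσ : ∀ z : Config N d (UnitAddTorus d), W (z ∘ σ : Config N d (UnitAddTorus d)) = W z) (τ : ℝ) (z : Config N d (UnitAddTorus d)) :
    (Alexander.good (Torus.geometry d) ε).indicator (fun z => W (Alexander.regFlow (Torus.geometry d) ε (-τ) z)) (z ∘ σ : Config N d (UnitAddTorus d)) =
      (Alexander.good (Torus.geometry d) ε).indicator (fun z => W (Alexander.regFlow (Torus.geometry d) ε (-τ) z)) z := by
  have hG := Torus.isHardSphereRegular_geometry (d := d) hε'
  by_cases hz : z ∈ Alexander.good (Torus.geometry d) ε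
  · rw [indicator_of_mem hz, indicator_of_mem ((Alexander.comp_perm_mem_good_iff hG σ z).2 hz), regFlow_comp_perm hε hε', hWσ]
  · rw [indicator_of_notMem hz, indicator_of_notMem (fun h => hz ((Alexander.comp_perm_mem_good_iff hG σ z).1 h))]

omit [Fintype d] in
/-- **The tagged block of the scattered partner**: for a tagged label `i' = castAdd m' i`,
`update Y i' (x_{i'}, u) ∘ castAdd m' = update (Y ∘ castAdd m') i (x_{i'}, u)`. [folklore] -/
theorem taggedBlock_update {k m' : ℕ} (i : Fin k) (Y : Config (k + m') d (UnitAddTorus d)) (val : UnitAddTorus d × EuclideanSpace ℝ d) :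
    (Function.update Y (Fin.castAdd m' i) val ∘ Fin.castAdd m' : Config k d (UnitAddTorus d)) =
      Function.update (Y ∘ Fin.castAdd m' : Config k d (UnitAddTorus d)) i val :=
  Function.update_comp_eq_of_injective Y (Fin.castAdd_injective _ _) i _

include hε hε' in
/-- **The flux integrand in the variables of `flux_bracket_eq_integral_mul_hsCollisionTerm`**:
`1_{good}(w) (ψ_τ(π w) - ψ_τ(π w')) W(Φ_{-τ} w) = (ψ(Y) - ψ((scatterParams i' ν (Y,v)).1)) · fden τ (w)`
for `w = lossConfig Y i' ν v`, `w' = collidePair I L w`, `ψ(Y) = ψ_τ(Y ∘ castAdd m')`. [folklore] -/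
theorem indicator_body_eq {k m' : ℕ} (i : Fin k) (S : Set (Config k d (UnitAddTorus d)))
    (W : Config (k + (m' + 1)) d (UnitAddTorus d) → ℝ) (τ : ℝ)
    (Y : Config (k + m') d (UnitAddTorus d)) (ν : sphere (0 : EuclideanSpace ℝ d) 1) (v : EuclideanSpace ℝ d) :
    (Alexander.good (Torus.geometry d) ε).indicator (fun w : Config (k + (m' + 1)) d (UnitAddTorus d) =>
        (S.indicator (1 : Config k d (UnitAddTorus d) → ℝ) (w ∘ Fin.castAdd (m' + 1)) -
          S.indicator (1 : Config k d (UnitAddTorus d) → ℝ)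
            (collidePair (Torus.geometry d) (Fin.castAdd (m' + 1) i) (Fin.natAdd k (Fin.last m')) w ∘ Fin.castAdd (m' + 1))) *
        W (Alexander.regFlow (Torus.geometry d) ε (-τ) w)) (lossConfig (Torus.geometry d) ε Y (Fin.castAdd m' i) ν v) =
      (S.indicator (1 : Config k d (UnitAddTorus d) → ℝ) (Y ∘ Fin.castAdd m') -
          S.indicator (1 : Config k d (UnitAddTorus d) → ℝ)
            (Function.update Y (Fin.castAdd m' i) ((Y (Fin.castAdd m' i)).1, (collide ν ((Y (Fin.castAdd m' i)).2, v)).1) ∘ Fin.castAdd m')) *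
        (Alexander.good (Torus.geometry d) ε).indicator (fun w => W (Alexander.regFlow (Torus.geometry d) ε (-τ) w))
          (lossConfig (Torus.geometry d) ε Y (Fin.castAdd m' i) ν v) := by
  set i' : Fin (k + m') := Fin.castAdd m' i with hi'
  have hI' : (Fin.castAdd 1 i' : Fin (k + m' + 1)) = Fin.castAdd (m' + 1) i := Fin.ext rfl
  have hL' : (Fin.natAdd (k + m') 0 : Fin (k + m' + 1)) = Fin.natAdd k (Fin.last m') := Fin.ext (by simp)
  have houtRep : ∀ w : Config (k + (m' + 1)) d (UnitAddTorus d), outRep (Torus.geometry d) (k + m') i' w =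
      collidePair (Torus.geometry d) (Fin.castAdd (m' + 1) i) (Fin.natAdd k (Fin.last m')) w := by
    intro w; unfold outRep; rw [hI', hL']
  have hπloss : (lossConfig (Torus.geometry d) ε Y i' ν v ∘ Fin.castAdd (m' + 1) : Config k d (UnitAddTorus d)) = (Y ∘ Fin.castAdd m') :=
    lossConfig_comp_castAdd_eq (Torus.geometry d) ε Y i' ν v
  have hπgain : (collidePair (Torus.geometry d) (Fin.castAdd (m' + 1) i) (Fin.natAdd k (Fin.last m')) (lossConfig (Torus.geometry d) ε Y i' ν v) ∘
      Fin.castAdd (m' + 1) : Config k d (UnitAddTorus d)) =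
      (Function.update Y i' ((Y i').1, (collide ν ((Y i').2, v)).1) ∘ Fin.castAdd m') := by
    rw [← houtRep, outRep_lossConfig_torus hε hε' Y i' ν v, gainConfig_comp_castAdd_eq (Torus.geometry d) ε Y i ν v, hi',
      taggedBlock_update, reflectVel_eq_collide]
  by_cases hg : lossConfig (Torus.geometry d) ε Y i' ν v ∈ Alexander.good (Torus.geometry d) ε
  · rw [indicator_of_mem hg, indicator_of_mem hg, hπloss, hπgain]
  · rw [indicator_of_notMem hg, indicator_of_notMem hg, mul_zero]

end Pointwise

section InnerFlux

variable {ε : ℝ} (hε : 0 < ε) (hε' : ε < 2⁻¹)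

/-- **The flux dominator is integrable over the collision coordinates at fixed time**:
`(1 + ‖v_i‖) e^{-βE(Y)} (1 + ‖v‖) e^{-β‖v‖²/2}` on `(Config × ℝ^d) × S^{d-1}`. [folklore] -/
theorem integrable_fluxDominator₃ {k m' : ℕ} (i' : Fin (k + m')) {β : ℝ} (hβ : 0 < β) :
    Integrable (fun q : (Config (k + m') d (UnitAddTorus d) × EuclideanSpace ℝ d) × sphere (0 : EuclideanSpace ℝ d) 1 =>
      ((1 + ‖(q.1.1 i').2‖) * Real.exp (-β * configEnergy q.1.1)) * ((1 + ‖q.1.2‖) * Real.exp (-(β / 2) * ‖q.1.2‖ ^ 2)))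
      (((volume : Measure (Config (k + m') d (UnitAddTorus d))).prod (volume : Measure (EuclideanSpace ℝ d))).prod
        ((volume : Measure (EuclideanSpace ℝ d)).toSphere)) := by
  haveI hXE : SigmaFinite (volume : Measure (UnitAddTorus d × EuclideanSpace ℝ d)) := inferInstance
  haveI hC : SigmaFinite (volume : Measure (Config (k + m') d (UnitAddTorus d))) := inferInstance
  haveI hσf : IsFiniteMeasure ((volume : Measure (EuclideanSpace ℝ d)).toSphere) := inferInstance
  haveI hσs : SigmaFinite ((volume : Measure (EuclideanSpace ℝ d)).toSphere) := inferInstance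
  haveI hAs : SigmaFinite (((volume : Measure (Config (k + m') d (UnitAddTorus d))).prod (volume : Measure (EuclideanSpace ℝ d)))) := inferInstance
  haveI hA3 : SigmaFinite ((((volume : Measure (Config (k + m') d (UnitAddTorus d))).prod (volume : Measure (EuclideanSpace ℝ d)))).prod ((volume : Measure (EuclideanSpace ℝ d)).toSphere)) := inferInstance
  haveI hSV : SigmaFinite ((((volume : Measure (EuclideanSpace ℝ d)).toSphere)).prod (volume : Measure (EuclideanSpace ℝ d))) := inferInstance
  haveI hVS : SigmaFinite ((volume : Measure (EuclideanSpace ℝ d)).prod ((volume : Measure (EuclideanSpace ℝ d)).toSphere)) := inferInstance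
  have h1 := integrable_one_add_norm_vel_mul_exp (d := d) i' hβ
  have h2 : Integrable (fun v : EuclideanSpace ℝ d => (1 + ‖v‖) * Real.exp (-(β / 2) * ‖v‖ ^ 2)) :=
    Literature.Analysis.FluidPDE.integrable_one_add_norm_mul_exp hβ
  have h12 := h1.mul_prod h2
  have h3 : Integrable (fun _ : sphere (0 : EuclideanSpace ℝ d) 1 => (1 : ℝ)) ((volume : Measure (EuclideanSpace ℝ d)).toSphere) := integrable_const 1
  have h := h12.mul_prod h3
  refine h.congr (Filter.Eventually.of_forall fun q => ?_)
  simp only [mul_one]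

/-- **Fubini for the collision coordinates, collision time outermost**: an integrable function on
`μP(S) = ((vol × vol) × (σ × vol|_S))` integrates as `∫_{τ ∈ S} ∫_{((Y,v),ν)}`. [folklore] -/
theorem integral_collisionCoords_eq_integral_time {k m' : ℕ} (S : Set ℝ)
    {G : (Config (k + m') d (UnitAddTorus d) × EuclideanSpace ℝ d) × (sphere (0 : EuclideanSpace ℝ d) 1 × ℝ) → ℝ}
    (hG : Integrable G ((((volume : Measure (Config (k + m') d (UnitAddTorus d))).prod (volume : Measure (EuclideanSpace ℝ d))).prod ((((volume : Measure (EuclideanSpace ℝ d)).toSphere).prod ((volume : Measure ℝ).restrict (S))))))) :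
    ∫ p, G p ∂((((volume : Measure (Config (k + m') d (UnitAddTorus d))).prod (volume : Measure (EuclideanSpace ℝ d))).prod ((((volume : Measure (EuclideanSpace ℝ d)).toSphere).prod ((volume : Measure ℝ).restrict (S)))))) =
      ∫ τ in S, ∫ q, G (q.1, (q.2, τ)) ∂(((volume : Measure (Config (k + m') d (UnitAddTorus d))).prod (volume : Measure (EuclideanSpace ℝ d))).prod ((volume : Measure (EuclideanSpace ℝ d)).toSphere)) := by
  haveI hXE : SigmaFinite (volume : Measure (UnitAddTorus d × EuclideanSpace ℝ d)) := inferInstance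
  haveI hC : SigmaFinite (volume : Measure (Config (k + m') d (UnitAddTorus d))) := inferInstance
  haveI hσf : IsFiniteMeasure ((volume : Measure (EuclideanSpace ℝ d)).toSphere) := inferInstance
  haveI hσs : SigmaFinite ((volume : Measure (EuclideanSpace ℝ d)).toSphere) := inferInstance
  haveI hAs : SigmaFinite (((volume : Measure (Config (k + m') d (UnitAddTorus d))).prod (volume : Measure (EuclideanSpace ℝ d)))) := inferInstance
  haveI hA3 : SigmaFinite ((((volume : Measure (Config (k + m') d (UnitAddTorus d))).prod (volume : Measure (EuclideanSpace ℝ d)))).prod ((volume : Measure (EuclideanSpace ℝ d)).toSphere)) := inferInstance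
  haveI hSV : SigmaFinite ((((volume : Measure (EuclideanSpace ℝ d)).toSphere)).prod (volume : Measure (EuclideanSpace ℝ d))) := inferInstance
  haveI hVS : SigmaFinite ((volume : Measure (EuclideanSpace ℝ d)).prod ((volume : Measure (EuclideanSpace ℝ d)).toSphere)) := inferInstance
  -- the rearrangement `(τ, (a, ν)) ↦ (a, (ν, τ))`
  have hfe : (fun r : ℝ × ((Config (k + m') d (UnitAddTorus d) × EuclideanSpace ℝ d) × sphere (0 : EuclideanSpace ℝ d) 1) => ((r.2.1, (r.2.2, r.1)) : (Config (k + m') d (UnitAddTorus d) × EuclideanSpace ℝ d) × (sphere (0 : EuclideanSpace ℝ d) 1 × ℝ))) =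
      (MeasurableEquiv.prodAssoc : ((Config (k + m') d (UnitAddTorus d) × EuclideanSpace ℝ d) × sphere (0 : EuclideanSpace ℝ d) 1) × ℝ ≃ᵐ (Config (k + m') d (UnitAddTorus d) × EuclideanSpace ℝ d) × (sphere (0 : EuclideanSpace ℝ d) 1 × ℝ)) ∘
        (Prod.swap : ℝ × ((Config (k + m') d (UnitAddTorus d) × EuclideanSpace ℝ d) × sphere (0 : EuclideanSpace ℝ d) 1) → ((Config (k + m') d (UnitAddTorus d) × EuclideanSpace ℝ d) × sphere (0 : EuclideanSpace ℝ d) 1) × ℝ) := by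
    funext r; rfl
  have he : MeasurePreserving (fun r : ℝ × ((Config (k + m') d (UnitAddTorus d) × EuclideanSpace ℝ d) × sphere (0 : EuclideanSpace ℝ d) 1) => ((r.2.1, (r.2.2, r.1)) : (Config (k + m') d (UnitAddTorus d) × EuclideanSpace ℝ d) × (sphere (0 : EuclideanSpace ℝ d) 1 × ℝ)))
      (((volume : Measure ℝ).restrict S).prod (((volume : Measure (Config (k + m') d (UnitAddTorus d))).prod (volume : Measure (EuclideanSpace ℝ d))).prod ((volume : Measure (EuclideanSpace ℝ d)).toSphere))) (((volume : Measure (Config (k + m') d (UnitAddTorus d))).prod (volume : Measure (EuclideanSpace ℝ d))).prod (((volume : Measure (EuclideanSpace ℝ d)).toSphere).prod ((volume : Measure ℝ).restrict S))) := by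
    rw [hfe]
    exact (MeasureTheory.measurePreserving_prodAssoc ((volume : Measure (Config (k + m') d (UnitAddTorus d))).prod (volume : Measure (EuclideanSpace ℝ d))) ((volume : Measure (EuclideanSpace ℝ d)).toSphere) ((volume : Measure ℝ).restrict S)).comp
      (Measure.measurePreserving_swap : MeasurePreserving (Prod.swap : ℝ × ((Config (k + m') d (UnitAddTorus d) × EuclideanSpace ℝ d) × sphere (0 : EuclideanSpace ℝ d) 1) → ((Config (k + m') d (UnitAddTorus d) × EuclideanSpace ℝ d) × sphere (0 : EuclideanSpace ℝ d) 1) × ℝ)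
        (((volume : Measure ℝ).restrict S).prod (((volume : Measure (Config (k + m') d (UnitAddTorus d))).prod (volume : Measure (EuclideanSpace ℝ d))).prod ((volume : Measure (EuclideanSpace ℝ d)).toSphere))) ((((volume : Measure (Config (k + m') d (UnitAddTorus d))).prod (volume : Measure (EuclideanSpace ℝ d))).prod ((volume : Measure (EuclideanSpace ℝ d)).toSphere)).prod ((volume : Measure ℝ).restrict S)))
  have hme : MeasurableEmbedding (fun r : ℝ × ((Config (k + m') d (UnitAddTorus d) × EuclideanSpace ℝ d) × sphere (0 : EuclideanSpace ℝ d) 1) => ((r.2.1, (r.2.2, r.1)) : (Config (k + m') d (UnitAddTorus d) × EuclideanSpace ℝ d) × (sphere (0 : EuclideanSpace ℝ d) 1 × ℝ))) := by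
    rw [hfe]
    exact (MeasurableEquiv.measurableEmbedding _).comp (MeasurableEquiv.prodComm.measurableEmbedding)
  rw [← he.integral_comp hme]
  have hGe : Integrable (fun r : ℝ × ((Config (k + m') d (UnitAddTorus d) × EuclideanSpace ℝ d) × sphere (0 : EuclideanSpace ℝ d) 1) => G (r.2.1, (r.2.2, r.1))) (((volume : Measure ℝ).restrict S).prod (((volume : Measure (Config (k + m') d (UnitAddTorus d))).prod (volume : Measure (EuclideanSpace ℝ d))).prod ((volume : Measure (EuclideanSpace ℝ d)).toSphere))) :=
    (he.integrable_comp_emb hme).2 hG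
  rw [integral_prod _ hGe]

include hε hε' in
/-- `flux_bracket_eq_integral_mul_hsCollisionTerm` at a general positive level `n`, with the
scattered partner written out (`scatterParams` unfolded). [cite: CIP1994, §4.3 (4.3.9)] -/
theorem flux_bracket_eq_integral_mul_hsCollisionTerm' {n : ℕ} [NeZero n] (i : Fin n)
    {P : Config (n + 1) d (UnitAddTorus d) → ℝ} (hPm : Measurable P) {K β : ℝ} (hK : 0 ≤ K) (hβ : 0 < β)
    (hP : ∀ W, |P W| ≤ K * Real.exp (-β * configEnergy W))
    {ψ : Config n d (UnitAddTorus d) → ℝ} (hψm : Measurable ψ) {Cψ : ℝ} (hψ : ∀ Y, |ψ Y| ≤ Cψ) :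
    ∫ Y : Config n d (UnitAddTorus d),
        ∫ q : sphere (0 : EuclideanSpace ℝ d) 1 × EuclideanSpace ℝ d,
          max ⟪(q.1 : EuclideanSpace ℝ d), q.2 - (Y i).2⟫_ℝ 0 *
            (ψ Y - ψ (Function.update Y i ((Y i).1, (collide q.1 ((Y i).2, q.2)).1))) * P (lossConfig (Torus.geometry d) ε Y i q.1 q.2)
          ∂(((volume : Measure (EuclideanSpace ℝ d)).toSphere).prod volume) =
      ∫ Y : Config n d (UnitAddTorus d),
        ψ Y * hsCollisionTerm (Torus.geometry d) ε n i (P ∘ outRep (Torus.geometry d) n i) Y := by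
  obtain ⟨m, rfl⟩ := Nat.exists_eq_succ_of_ne_zero (NeZero.ne n)
  exact flux_bracket_eq_integral_mul_hsCollisionTerm (d := d) hε hε' i hPm hK hβ hP hψm hψ

set_option maxHeartbeats 1600000 in
include hε hε' in
/-- **The flux integral at fixed collision time is `ε^{d-1} ∫ ψ · hsCollisionTerm`** (the core
rearrangement): for a measurable set `S` of tagged configurations and the weight
`fden τ = 1_{good} · W ∘ Φ_{-τ}`,
`∫_{((Y,v),ν)} ε^{d-1}(⟪v - v_{i'}, ν⟫)₊ 1_{good}(w)(1_S(π w) - 1_S(π w')) W(Φ_{-τ} w)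
  = ε^{d-1} ∫_Y 1_S(Y ∘ castAdd m') · hsCollisionTerm (k+m') i' (fden τ ∘ outRep i') (Y) dY`
(`flux_bracket_eq_integral_mul_hsCollisionTerm` after Fubini). [cite: CIP1994, §4.3 (4.3.9)] -/
theorem inner_flux_eq [Nonempty d] {k m' : ℕ} [NeZero k] (i : Fin k) {S : Set (Config k d (UnitAddTorus d))} (hS : MeasurableSet S)
    {W : Config (k + (m' + 1)) d (UnitAddTorus d) → ℝ} (hW : Measurable W)
    {CW β : ℝ} (hCW : 0 ≤ CW) (hβ : 0 < β) (hWb : ∀ z, |W z| ≤ CW * Real.exp (-β * configEnergy z)) (τ : ℝ) :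
    ∫ q, ε ^ (Fintype.card d - 1) * max ⟪q.1.2 - (q.1.1 (Fin.castAdd m' i)).2, (q.2 : EuclideanSpace ℝ d)⟫_ℝ 0 *
        (Alexander.good (Torus.geometry d) ε).indicator (fun w : Config (k + (m' + 1)) d (UnitAddTorus d) =>
          (S.indicator (1 : Config k d (UnitAddTorus d) → ℝ) (w ∘ Fin.castAdd (m' + 1)) -
            S.indicator (1 : Config k d (UnitAddTorus d) → ℝ)
              (collidePair (Torus.geometry d) (Fin.castAdd (m' + 1) i) (Fin.natAdd k (Fin.last m')) w ∘ Fin.castAdd (m' + 1))) *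
          W (Alexander.regFlow (Torus.geometry d) ε (-τ) w)) (lossConfig (Torus.geometry d) ε q.1.1 (Fin.castAdd m' i) q.2 q.1.2)
      ∂(((volume : Measure (Config (k + m') d (UnitAddTorus d))).prod (volume : Measure (EuclideanSpace ℝ d))).prod
        ((volume : Measure (EuclideanSpace ℝ d)).toSphere)) =
      ε ^ (Fintype.card d - 1) * ∫ Y : Config (k + m') d (UnitAddTorus d),
        S.indicator (1 : Config k d (UnitAddTorus d) → ℝ) (Y ∘ Fin.castAdd m') *
          hsCollisionTerm (Torus.geometry d) ε (k + m') (Fin.castAdd m' i)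
            ((Alexander.good (Torus.geometry d) ε).indicator (fun w => W (Alexander.regFlow (Torus.geometry d) ε (-τ) w)) ∘
              outRep (Torus.geometry d) (k + m') (Fin.castAdd m' i)) Y := by
  classical
  haveI hXE : SigmaFinite (volume : Measure (UnitAddTorus d × EuclideanSpace ℝ d)) := inferInstance
  haveI hC : SigmaFinite (volume : Measure (Config (k + m') d (UnitAddTorus d))) := inferInstance
  haveI hσf : IsFiniteMeasure ((volume : Measure (EuclideanSpace ℝ d)).toSphere) := inferInstance
  haveI hσs : SigmaFinite ((volume : Measure (EuclideanSpace ℝ d)).toSphere) := inferInstance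
  haveI hAs : SigmaFinite (((volume : Measure (Config (k + m') d (UnitAddTorus d))).prod (volume : Measure (EuclideanSpace ℝ d)))) := inferInstance
  haveI hA3 : SigmaFinite ((((volume : Measure (Config (k + m') d (UnitAddTorus d))).prod (volume : Measure (EuclideanSpace ℝ d)))).prod ((volume : Measure (EuclideanSpace ℝ d)).toSphere)) := inferInstance
  haveI hSV : SigmaFinite ((((volume : Measure (EuclideanSpace ℝ d)).toSphere)).prod (volume : Measure (EuclideanSpace ℝ d))) := inferInstance
  haveI hVS : SigmaFinite ((volume : Measure (EuclideanSpace ℝ d)).prod ((volume : Measure (EuclideanSpace ℝ d)).toSphere)) := inferInstance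
  haveI : NeZero (k + m') := ⟨by have := NeZero.ne k; omega⟩
  have hG := Torus.isHardSphereRegular_geometry (d := d) hε'
  have hGm := Torus.isMeasurable_geometry (d := d)
  set i' : Fin (k + m') := Fin.castAdd m' i with hi'
  set fden : Config (k + (m' + 1)) d (UnitAddTorus d) → ℝ :=
    (Alexander.good (Torus.geometry d) ε).indicator (fun w => W (Alexander.regFlow (Torus.geometry d) ε (-τ) w)) with hfden
  set ψ : Config (k + m') d (UnitAddTorus d) → ℝ := fun Y => S.indicator (1 : Config k d (UnitAddTorus d) → ℝ) (Y ∘ Fin.castAdd m') with hψ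
  -- the integrand in the variables `(Y, (ω, v))`
  set T : Config (k + m') d (UnitAddTorus d) → sphere (0 : EuclideanSpace ℝ d) 1 × EuclideanSpace ℝ d → ℝ := fun Y q =>
    max ⟪(q.1 : EuclideanSpace ℝ d), q.2 - (Y i').2⟫_ℝ 0 * (ψ Y - ψ (Function.update Y i' ((Y i').1, (collide q.1 ((Y i').2, q.2)).1))) *
      fden (lossConfig (Torus.geometry d) ε Y i' q.1 q.2)
    with hT
  have hptw : ∀ q : (Config (k + m') d (UnitAddTorus d) × EuclideanSpace ℝ d) × sphere (0 : EuclideanSpace ℝ d) 1,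
      ε ^ (Fintype.card d - 1) * max ⟪q.1.2 - (q.1.1 i').2, (q.2 : EuclideanSpace ℝ d)⟫_ℝ 0 *
        (Alexander.good (Torus.geometry d) ε).indicator (fun w : Config (k + (m' + 1)) d (UnitAddTorus d) =>
          (S.indicator (1 : Config k d (UnitAddTorus d) → ℝ) (w ∘ Fin.castAdd (m' + 1)) -
            S.indicator (1 : Config k d (UnitAddTorus d) → ℝ)
              (collidePair (Torus.geometry d) (Fin.castAdd (m' + 1) i) (Fin.natAdd k (Fin.last m')) w ∘ Fin.castAdd (m' + 1))) *
          W (Alexander.regFlow (Torus.geometry d) ε (-τ) w)) (lossConfig (Torus.geometry d) ε q.1.1 i' q.2 q.1.2) =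
      ε ^ (Fintype.card d - 1) * T q.1.1 (q.2, q.1.2) := by
    intro q
    rw [indicator_body_eq hε hε' i S W τ q.1.1 q.2 q.1.2, real_inner_comm]
    simp only [hT, hψ, hfden]
    ring
  simp_rw [hptw]
  rw [integral_const_mul]
  congr 1
  -- bounds and measurability
  have hfden_m : Measurable fden := by
    simp only [hfden]
    exact (hW.comp (Alexander.measurable_regFlow hε' _)).indicator (Alexander.measurableSet_good hG hGm)
  have hfden_b : ∀ w, |fden w| ≤ CW * Real.exp (-β * configEnergy w) := by
    intro w
    simp only [hfden]
    by_cases hw : w ∈ Alexander.good (Torus.geometry d) ε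
    · rw [indicator_of_mem hw]
      have h := hWb (Alexander.regFlow (Torus.geometry d) ε (-τ) w)
      rwa [Alexander.configEnergy_regFlow] at h
    · rw [indicator_of_notMem hw, abs_zero]; positivity
  have hπm : Measurable fun Y : Config (k + m') d (UnitAddTorus d) => (Y ∘ Fin.castAdd m' : Config k d (UnitAddTorus d)) :=
    measurable_pi_lambda _ fun j => measurable_pi_apply _
  have hψm : Measurable ψ := by simp only [hψ]; exact (measurable_const.indicator hS).comp hπm
  have hψb : ∀ Y, |ψ Y| ≤ 1 := by
    intro Y; simp only [hψ]
    by_cases h : (Y ∘ Fin.castAdd m' : Config k d (UnitAddTorus d)) ∈ S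
    · rw [indicator_of_mem h, Pi.one_apply, abs_one]
    · rw [indicator_of_notMem h, abs_zero]; exact zero_le_one
  -- the core rearrangement in the variables `(Y, (ω, v))`
  have hcore := flux_bracket_eq_integral_mul_hsCollisionTerm' (d := d) hε hε' i' hfden_m hCW hβ hfden_b hψm hψb
  -- Fubini: `((Y, v), ω) ↦ (Y, (ω, v))`
  have hfe : (fun r : Config (k + m') d (UnitAddTorus d) × (sphere (0 : EuclideanSpace ℝ d) 1 × EuclideanSpace ℝ d) => (((r.1, r.2.2), r.2.1) : (Config (k + m') d (UnitAddTorus d) × EuclideanSpace ℝ d) × sphere (0 : EuclideanSpace ℝ d) 1)) =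
      (MeasurableEquiv.prodAssoc.symm : Config (k + m') d (UnitAddTorus d) × (EuclideanSpace ℝ d × sphere (0 : EuclideanSpace ℝ d) 1) ≃ᵐ (Config (k + m') d (UnitAddTorus d) × EuclideanSpace ℝ d) × sphere (0 : EuclideanSpace ℝ d) 1) ∘
        (Prod.map id Prod.swap : Config (k + m') d (UnitAddTorus d) × (sphere (0 : EuclideanSpace ℝ d) 1 × EuclideanSpace ℝ d) → Config (k + m') d (UnitAddTorus d) × (EuclideanSpace ℝ d × sphere (0 : EuclideanSpace ℝ d) 1)) := by
    funext r; rfl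
  have he : MeasurePreserving (fun r : Config (k + m') d (UnitAddTorus d) × (sphere (0 : EuclideanSpace ℝ d) 1 × EuclideanSpace ℝ d) => (((r.1, r.2.2), r.2.1) : (Config (k + m') d (UnitAddTorus d) × EuclideanSpace ℝ d) × sphere (0 : EuclideanSpace ℝ d) 1))
      ((volume : Measure (Config (k + m') d (UnitAddTorus d))).prod (((volume : Measure (EuclideanSpace ℝ d)).toSphere).prod (volume : Measure (EuclideanSpace ℝ d)))) (((volume : Measure (Config (k + m') d (UnitAddTorus d))).prod (volume : Measure (EuclideanSpace ℝ d))).prod ((volume : Measure (EuclideanSpace ℝ d)).toSphere)) := by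
    rw [hfe]
    have h1 : MeasurePreserving (Prod.map id Prod.swap : Config (k + m') d (UnitAddTorus d) × (sphere (0 : EuclideanSpace ℝ d) 1 × EuclideanSpace ℝ d) → Config (k + m') d (UnitAddTorus d) × (EuclideanSpace ℝ d × sphere (0 : EuclideanSpace ℝ d) 1))
        ((volume : Measure (Config (k + m') d (UnitAddTorus d))).prod (((volume : Measure (EuclideanSpace ℝ d)).toSphere).prod (volume : Measure (EuclideanSpace ℝ d))))
        ((volume : Measure (Config (k + m') d (UnitAddTorus d))).prod ((volume : Measure (EuclideanSpace ℝ d)).prod ((volume : Measure (EuclideanSpace ℝ d)).toSphere))) :=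
      (MeasurePreserving.id _).prod Measure.measurePreserving_swap
    exact ((MeasureTheory.measurePreserving_prodAssoc (volume : Measure (Config (k + m') d (UnitAddTorus d))) (volume : Measure (EuclideanSpace ℝ d)) ((volume : Measure (EuclideanSpace ℝ d)).toSphere)).symm _).comp h1
  have hme : MeasurableEmbedding (fun r : Config (k + m') d (UnitAddTorus d) × (sphere (0 : EuclideanSpace ℝ d) 1 × EuclideanSpace ℝ d) => (((r.1, r.2.2), r.2.1) : (Config (k + m') d (UnitAddTorus d) × EuclideanSpace ℝ d) × sphere (0 : EuclideanSpace ℝ d) 1)) := by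
    rw [hfe]
    exact (MeasurableEquiv.measurableEmbedding _).comp
      ((MeasurableEquiv.prodCongr (MeasurableEquiv.refl _) MeasurableEquiv.prodComm).measurableEmbedding)
  -- integrability of `T` on `A.prod σ` (Gaussian flux dominator)
  have hTm : Measurable fun q : (Config (k + m') d (UnitAddTorus d) × EuclideanSpace ℝ d) × sphere (0 : EuclideanSpace ℝ d) 1 => T q.1.1 (q.2, q.1.2) := by
    have hY : Measurable fun q : (Config (k + m') d (UnitAddTorus d) × EuclideanSpace ℝ d) × sphere (0 : EuclideanSpace ℝ d) 1 => q.1.1 := measurable_fst.fst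
    have hv : Measurable fun q : (Config (k + m') d (UnitAddTorus d) × EuclideanSpace ℝ d) × sphere (0 : EuclideanSpace ℝ d) 1 => q.1.2 := measurable_fst.snd
    have hω : Measurable fun q : (Config (k + m') d (UnitAddTorus d) × EuclideanSpace ℝ d) × sphere (0 : EuclideanSpace ℝ d) 1 => (q.2 : EuclideanSpace ℝ d) :=
      continuous_subtype_val.measurable.comp measurable_snd
    have hvi : Measurable fun q : (Config (k + m') d (UnitAddTorus d) × EuclideanSpace ℝ d) × sphere (0 : EuclideanSpace ℝ d) 1 => (q.1.1 i').2 :=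
      ((measurable_pi_apply i').comp hY).snd
    have hsP : Measurable fun q : (Config (k + m') d (UnitAddTorus d) × EuclideanSpace ℝ d) × sphere (0 : EuclideanSpace ℝ d) 1 =>
        Function.update q.1.1 i' ((q.1.1 i').1, (collide q.2 ((q.1.1 i').2, q.1.2)).1) := by
      have hcol : Measurable fun q : (Config (k + m') d (UnitAddTorus d) × EuclideanSpace ℝ d) × sphere (0 : EuclideanSpace ℝ d) 1 =>
          (collide q.2 ((q.1.1 i').2, q.1.2)).1 := by
        have hin : Measurable fun q : (Config (k + m') d (UnitAddTorus d) × EuclideanSpace ℝ d) × sphere (0 : EuclideanSpace ℝ d) 1 =>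
            ⟪(q.1.1 i').2 - q.1.2, (q.2 : EuclideanSpace ℝ d)⟫_ℝ := (hvi.sub hv).inner hω
        simp only [collide]
        exact hvi.sub (hin.smul hω)
      exact measurable_update'.comp (hY.prodMk (((measurable_pi_apply i').comp hY).fst.prodMk hcol))
    have hloss := measurable_lossConfig hGm.measurable_translate ε i' hY hω hv
    simp only [hT]
    exact (((hω.inner (hv.sub hvi)).max measurable_const).mul ((hψm.comp hY).sub (hψm.comp hsP))).mul (hfden_m.comp hloss)
  have hTi : Integrable (fun q : (Config (k + m') d (UnitAddTorus d) × EuclideanSpace ℝ d) × sphere (0 : EuclideanSpace ℝ d) 1 => T q.1.1 (q.2, q.1.2)) (((volume : Measure (Config (k + m') d (UnitAddTorus d))).prod (volume : Measure (EuclideanSpace ℝ d))).prod ((volume : Measure (EuclideanSpace ℝ d)).toSphere)) := by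
    have hDom := (integrable_fluxDominator₃ (d := d) (k := k) (m' := m') i' hβ).const_mul (2 * CW)
    refine hDom.mono' hTm.aestronglyMeasurable (Filter.Eventually.of_forall fun q => ?_)
    simp only [hT]
    rw [Real.norm_eq_abs, abs_mul, abs_mul]
    have h1 : |max ⟪(q.2 : EuclideanSpace ℝ d), q.1.2 - (q.1.1 i').2⟫_ℝ 0| ≤ (1 + ‖(q.1.1 i').2‖) * (1 + ‖q.1.2‖) := by
      rw [abs_of_nonneg (le_max_right _ _)]
      refine max_le ?_ (by positivity)
      calc ⟪(q.2 : EuclideanSpace ℝ d), q.1.2 - (q.1.1 i').2⟫_ℝ ≤ ‖(q.2 : EuclideanSpace ℝ d)‖ * ‖q.1.2 - (q.1.1 i').2‖ := real_inner_le_norm _ _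
        _ = ‖q.1.2 - (q.1.1 i').2‖ := by rw [norm_eq_of_mem_sphere q.2, one_mul]
        _ ≤ ‖q.1.2‖ + ‖(q.1.1 i').2‖ := norm_sub_le _ _
        _ ≤ (1 + ‖(q.1.1 i').2‖) * (1 + ‖q.1.2‖) := by nlinarith [norm_nonneg q.1.2, norm_nonneg (q.1.1 i').2]
    have h2 : |ψ q.1.1 - ψ (Function.update q.1.1 i' ((q.1.1 i').1, (collide q.2 ((q.1.1 i').2, q.1.2)).1))| ≤ 2 := by
      have ha := hψb q.1.1
      have hb := hψb (Function.update q.1.1 i' ((q.1.1 i').1, (collide q.2 ((q.1.1 i').2, q.1.2)).1))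
      rw [abs_le] at ha hb ⊢; constructor <;> linarith [ha.1, ha.2, hb.1, hb.2]
    have h3 := hfden_b (lossConfig (Torus.geometry d) ε q.1.1 i' q.2 q.1.2)
    rw [configEnergy_lossConfig] at h3
    have hexp : Real.exp (-β * (configEnergy q.1.1 + 2⁻¹ * ‖q.1.2‖ ^ 2)) = Real.exp (-β * configEnergy q.1.1) * Real.exp (-(β / 2) * ‖q.1.2‖ ^ 2) := by
      rw [← Real.exp_add]; congr 1; ring
    rw [hexp] at h3
    calc |max ⟪(q.2 : EuclideanSpace ℝ d), q.1.2 - (q.1.1 i').2⟫_ℝ 0| *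
          |ψ q.1.1 - ψ (Function.update q.1.1 i' ((q.1.1 i').1, (collide q.2 ((q.1.1 i').2, q.1.2)).1))| *
          |fden (lossConfig (Torus.geometry d) ε q.1.1 i' q.2 q.1.2)|
        ≤ ((1 + ‖(q.1.1 i').2‖) * (1 + ‖q.1.2‖)) * 2 * (CW * (Real.exp (-β * configEnergy q.1.1) * Real.exp (-(β / 2) * ‖q.1.2‖ ^ 2))) :=
          mul_le_mul (mul_le_mul h1 h2 (abs_nonneg _) (by positivity)) h3 (abs_nonneg _) (by positivity)
      _ = _ := by ring
  -- assemble
  have hstep : ∫ q, T q.1.1 (q.2, q.1.2) ∂(((volume : Measure (Config (k + m') d (UnitAddTorus d))).prod (volume : Measure (EuclideanSpace ℝ d))).prod ((volume : Measure (EuclideanSpace ℝ d)).toSphere)) =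
      ∫ r, T r.1 r.2 ∂((volume : Measure (Config (k + m') d (UnitAddTorus d))).prod (((volume : Measure (EuclideanSpace ℝ d)).toSphere).prod (volume : Measure (EuclideanSpace ℝ d)))) := by
    rw [← he.integral_comp hme]
  rw [hstep]
  have hTi' : Integrable (fun r : Config (k + m') d (UnitAddTorus d) × (sphere (0 : EuclideanSpace ℝ d) 1 × EuclideanSpace ℝ d) => T r.1 r.2)
      ((volume : Measure (Config (k + m') d (UnitAddTorus d))).prod (((volume : Measure (EuclideanSpace ℝ d)).toSphere).prod (volume : Measure (EuclideanSpace ℝ d)))) := (he.integrable_comp_emb hme).2 hTi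
  rw [integral_prod _ hTi']
  simp only [hT] at hcore ⊢
  exact hcore

end InnerFlux

section Marginal

variable {ε : ℝ} (hε : 0 < ε) (hε' : ε < 2⁻¹)

omit [Fintype d] in
/-- Updating a tagged entry of a juxtaposition updates the tagged block. [folklore] -/
theorem update_append_castAdd {k m : ℕ} {α : Type*} (a : Fin k → α) (b : Fin m → α) (i : Fin k) (val : α) :
    Function.update (Fin.append a b) (Fin.castAdd m i) val = Fin.append (Function.update a i val) b := by
  ext j
  refine Fin.addCases (fun j₁ => ?_) (fun j₂ => ?_) j
  · rw [Fin.append_left]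
    by_cases h : j₁ = i
    · subst h; rw [Function.update_self, Function.update_self]
    · rw [Function.update_of_ne (fun h' => h (Fin.castAdd_injective _ _ h')), Function.update_of_ne h, Fin.append_left]
  · have hne : Fin.natAdd k j₂ ≠ Fin.castAdd m i := fun h => by
      have := congrArg Fin.val h; simp at this; omega
    rw [Function.update_of_ne hne, Fin.append_right, Fin.append_right]

omit [Fintype d] in
/-- The loss configuration of a juxtaposition at a tagged label. [folklore] -/
theorem lossConfig_append_castAdd [Fintype d] {X : Type*} (G : Geometry d X) (ε : ℝ) {k m' : ℕ} (Yk : Config k d X) (Zm : Config m' d X)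
    (i : Fin k) (ω v : EuclideanSpace ℝ d) :
    lossConfig G ε (Fin.append Yk Zm) (Fin.castAdd m' i) ω v = appendParticle (Fin.append Yk Zm) (G.translate (Yk i).1 (ε • ω)) v := by
  unfold lossConfig
  rw [Fin.append_left]

omit [Fintype d] in
/-- The gain configuration of a juxtaposition at a tagged label. [folklore] -/
theorem gainConfig_append_castAdd [Fintype d] {X : Type*} (G : Geometry d X) (ε : ℝ) {k m' : ℕ} (Yk : Config k d X) (Zm : Config m' d X)
    (i : Fin k) (ω v : EuclideanSpace ℝ d) :
    gainConfig G ε (Fin.append Yk Zm) (Fin.castAdd m' i) ω v =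
      appendParticle (Fin.append (Function.update Yk i ((Yk i).1, (reflectVel ω ((Yk i).2, v)).1)) Zm)
        (G.translate (Yk i).1 (ε • ω)) (reflectVel ω ((Yk i).2, v)).2 := by
  unfold gainConfig
  rw [update_append_castAdd, Fin.append_left]

include hε hε' in
/-- **Marginalising the untagged spectators in the collision term** (the `(k+1)`-marginal appears):
for the transported density `fden = 1_{good} · W ∘ Φ_{-τ}` with `W` symmetric in the untagged
labels, and every tagged configuration `Yk`,
`∫ hsCollisionTerm (k+m') i' (fden ∘ outRep i') (Yk, Zm) dZm = hsCollisionTerm k i (f_{k+1} ∘ outRep i) (Yk)`,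
where `f_{k+1} = nthMarginal (k+1+m') (k+1) fden` (`nthMarginal_appendParticle_eq_of_restSymmetric`,
`outRep_gainConfig_torus`, `outRep_lossConfig_torus`, Fubini). [cite: CIP1994, §4.3 (4.3.9)] -/

theorem integral_hsCollisionTerm_append_eq [Nonempty d] {k m' : ℕ} [NeZero k] (i : Fin k)
    {W : Config (k + (m' + 1)) d (UnitAddTorus d) → ℝ} (hW : Measurable W)
    (hWσ : ∀ σ : Equiv.Perm (Fin (k + (m' + 1))), (∀ j : Fin k, σ (Fin.castAdd (m' + 1) j) = Fin.castAdd (m' + 1) j) →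
      ∀ z : Config (k + (m' + 1)) d (UnitAddTorus d), W (z ∘ σ : Config (k + (m' + 1)) d (UnitAddTorus d)) = W z)
    {CW β : ℝ} (hCW : 0 ≤ CW) (hβ : 0 < β) (hWb : ∀ z, |W z| ≤ CW * Real.exp (-β * configEnergy z)) (τ : ℝ)
    (hkm : k + (m' + 1) = k + 1 + m') (Yk : Config k d (UnitAddTorus d)) :
    ∫ Zm : Config m' d (UnitAddTorus d), hsCollisionTerm (Torus.geometry d) ε (k + m') (Fin.castAdd m' i)
        ((Alexander.good (Torus.geometry d) ε).indicator (fun w => W (Alexander.regFlow (Torus.geometry d) ε (-τ) w)) ∘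
          outRep (Torus.geometry d) (k + m') (Fin.castAdd m' i)) (Fin.append Yk Zm) =
      hsCollisionTerm (Torus.geometry d) ε k i
        ((nthMarginal (k + 1 + m') (k + 1) (fun z : Config (k + 1 + m') d (UnitAddTorus d) =>
            (Alexander.good (Torus.geometry d) ε).indicator (fun w => W (Alexander.regFlow (Torus.geometry d) ε (-τ) w))
              (fun j => z (Fin.cast hkm j)))) ∘ outRep (Torus.geometry d) k i) Yk := by
  haveI hXE : SigmaFinite (volume : Measure (UnitAddTorus d × EuclideanSpace ℝ d)) := inferInstance
  haveI hCm : SigmaFinite (volume : Measure (Config m' d (UnitAddTorus d))) := inferInstance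
  haveI hσf : IsFiniteMeasure ((volume : Measure (EuclideanSpace ℝ d)).toSphere) := inferInstance
  haveI hσs : SigmaFinite ((volume : Measure (EuclideanSpace ℝ d)).toSphere) := inferInstance
  haveI hSV : SigmaFinite ((((volume : Measure (EuclideanSpace ℝ d)).toSphere)).prod (volume : Measure (EuclideanSpace ℝ d))) := inferInstance
  haveI hP3 : SigmaFinite ((volume : Measure (Config m' d (UnitAddTorus d))).prod
      ((((volume : Measure (EuclideanSpace ℝ d)).toSphere)).prod (volume : Measure (EuclideanSpace ℝ d)))) := inferInstance
  haveI : NeZero (k + m') := ⟨by have := NeZero.ne k; omega⟩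
  have hG := Torus.isHardSphereRegular_geometry (d := d) hε'
  have hGm := Torus.isMeasurable_geometry (d := d)
  set fden : Config (k + (m' + 1)) d (UnitAddTorus d) → ℝ :=
    (Alexander.good (Torus.geometry d) ε).indicator (fun w => W (Alexander.regFlow (Torus.geometry d) ε (-τ) w)) with hfden
  set F : Config (k + 1 + m') d (UnitAddTorus d) → ℝ := fun z => fden (fun j => z (Fin.cast hkm j)) with hF
  set fk1 : Config (k + 1) d (UnitAddTorus d) → ℝ := nthMarginal (k + 1 + m') (k + 1) F with hfk1
  show ∫ Zm : Config m' d (UnitAddTorus d), hsCollisionTerm (Torus.geometry d) ε (k + m') (Fin.castAdd m' i) (fden ∘ outRep (Torus.geometry d) (k + m') (Fin.castAdd m' i)) (Fin.append Yk Zm) =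
    hsCollisionTerm (Torus.geometry d) ε k i (fk1 ∘ outRep (Torus.geometry d) k i) Yk
  -- bounds and measurability of `fden`
  have hfden_m : Measurable fden := by
    simp only [hfden]
    exact (hW.comp (Alexander.measurable_regFlow hε' _)).indicator (Alexander.measurableSet_good hG hGm)
  have hfden_b : ∀ w, |fden w| ≤ CW * Real.exp (-β * configEnergy w) := by
    intro w
    simp only [hfden]
    by_cases hw : w ∈ Alexander.good (Torus.geometry d) ε
    · rw [indicator_of_mem hw]
      have h := hWb (Alexander.regFlow (Torus.geometry d) ε (-τ) w)
      rwa [Alexander.configEnergy_regFlow] at h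
    · rw [indicator_of_notMem hw, abs_zero]; positivity
  -- rest-symmetry of `F`
  have hFσ : ∀ σ : Equiv.Perm (Fin (k + 1 + m')), (∀ j : Fin k, σ (Fin.cast (by omega) (Fin.castAdd (m' + 1) j)) =
      Fin.cast (by omega) (Fin.castAdd (m' + 1) j)) → ∀ w : Config (k + 1 + m') d (UnitAddTorus d), F (w ∘ σ) = F w := by
    intro σ hσ w
    set σ' : Equiv.Perm (Fin (k + (m' + 1))) := (finCongr hkm).trans (σ.trans (finCongr hkm).symm) with hσ'
    have hfix : ∀ j : Fin k, σ' (Fin.castAdd (m' + 1) j) = Fin.castAdd (m' + 1) j := by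
      intro j
      apply Fin.ext
      have h := congrArg Fin.val (hσ j)
      simp only [Fin.val_cast] at h
      simp only [hσ', Equiv.trans_apply, finCongr_apply, finCongr_symm, Fin.val_cast]
      exact h
    have heq : (fun j => (w ∘ σ) (Fin.cast hkm j)) = ((fun j => w (Fin.cast hkm j)) ∘ σ' : Config (k + (m' + 1)) d (UnitAddTorus d)) := by
      funext j
      simp only [Function.comp_apply, hσ', Equiv.trans_apply, finCongr_apply, finCongr_symm]
      congr 1
    simp only [hF]
    rw [heq]
    exact fden_comp_perm hε hε' σ' (hWσ σ' hfix) τ _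
  -- the two marginal identities (T5b)
  have hT5b := fun (Y : Config k d (UnitAddTorus d)) (x : UnitAddTorus d) (v : EuclideanSpace ℝ d) =>
    nthMarginal_appendParticle_eq_of_restSymmetric (d := d) (s := k) (m := m') (F := F) hFσ Y x v
  have hcast : ∀ (Y : Config k d (UnitAddTorus d)) (zm : Config m' d (UnitAddTorus d)) (x : UnitAddTorus d) (v : EuclideanSpace ℝ d),
      F (fun j => appendParticle (Fin.append Y zm) x v (Fin.cast (Nat.add_right_comm k 1 m') j)) = fden (appendParticle (Fin.append Y zm) x v) := by
    intro Y zm x v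
    simp only [hF]
    rfl
  have hloss_marg : ∀ (ω : sphere (0 : EuclideanSpace ℝ d) 1) (v : EuclideanSpace ℝ d),
      ∫ Zm : Config m' d (UnitAddTorus d), fden (lossConfig (Torus.geometry d) ε (Fin.append Yk Zm) (Fin.castAdd m' i) ω v) =
        fk1 (lossConfig (Torus.geometry d) ε Yk i ω v) := by
    intro ω v
    have h := hT5b Yk ((Torus.geometry d).translate (Yk i).1 (ε • (ω : EuclideanSpace ℝ d))) v
    simp only [hcast] at h
    simp only [hfk1, lossConfig_append_castAdd]
    rw [← h]
    rfl
  have hgain_marg : ∀ (ω : sphere (0 : EuclideanSpace ℝ d) 1) (v : EuclideanSpace ℝ d),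
      ∫ Zm : Config m' d (UnitAddTorus d), fden (gainConfig (Torus.geometry d) ε (Fin.append Yk Zm) (Fin.castAdd m' i) ω v) =
        fk1 (gainConfig (Torus.geometry d) ε Yk i ω v) := by
    intro ω v
    have h := hT5b (Function.update Yk i ((Yk i).1, (reflectVel (ω : EuclideanSpace ℝ d) ((Yk i).2, v)).1))
      ((Torus.geometry d).translate (Yk i).1 (ε • (ω : EuclideanSpace ℝ d))) (reflectVel (ω : EuclideanSpace ℝ d) ((Yk i).2, v)).2
    simp only [hcast] at h
    simp only [hfk1, gainConfig_append_castAdd]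
    rw [← h]
    rfl
  -- the integrand over `(Zm, (ω, v))`
  set a : sphere (0 : EuclideanSpace ℝ d) 1 × EuclideanSpace ℝ d → ℝ := fun q => max ⟪(q.1 : EuclideanSpace ℝ d), q.2 - (Yk i).2⟫_ℝ 0 with ha
  set b : sphere (0 : EuclideanSpace ℝ d) 1 × EuclideanSpace ℝ d → ℝ := fun q => max (-⟪(q.1 : EuclideanSpace ℝ d), q.2 - (Yk i).2⟫_ℝ) 0 with hb
  set Φ : Config m' d (UnitAddTorus d) → sphere (0 : EuclideanSpace ℝ d) 1 × EuclideanSpace ℝ d → ℝ := fun Zm q =>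
    a q * fden (lossConfig (Torus.geometry d) ε (Fin.append Yk Zm) (Fin.castAdd m' i) q.1 q.2) -
      b q * fden (gainConfig (Torus.geometry d) ε (Fin.append Yk Zm) (Fin.castAdd m' i) q.1 q.2) with hΦ
  have hvi : ∀ Zm : Config m' d (UnitAddTorus d), (Fin.append Yk Zm (Fin.castAdd m' i)).2 = (Yk i).2 := by
    intro Zm; simp only [Fin.append_left]
  have hHs : ∀ Zm : Config m' d (UnitAddTorus d),
      hsCollisionTerm (Torus.geometry d) ε (k + m') (Fin.castAdd m' i) (fden ∘ outRep (Torus.geometry d) (k + m') (Fin.castAdd m' i)) (Fin.append Yk Zm) =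
        ∫ ω, (∫ v, Φ Zm (ω, v)) ∂((volume : Measure (EuclideanSpace ℝ d)).toSphere) := by
    intro Zm
    simp only [hsCollisionTerm, sphereMeasure, Function.comp_apply, outRep_gainConfig_torus hε hε', outRep_lossConfig_torus hε hε', hvi, hΦ, ha, hb]
  simp_rw [hHs]
  -- bounds
  have hab_le : ∀ q : sphere (0 : EuclideanSpace ℝ d) 1 × EuclideanSpace ℝ d, |a q| ≤ (1 + ‖(Yk i).2‖) * (1 + ‖q.2‖) ∧ |b q| ≤ (1 + ‖(Yk i).2‖) * (1 + ‖q.2‖) := by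
    intro q
    have hin : |⟪(q.1 : EuclideanSpace ℝ d), q.2 - (Yk i).2⟫_ℝ| ≤ (1 + ‖(Yk i).2‖) * (1 + ‖q.2‖) := by
      calc _ ≤ ‖(q.1 : EuclideanSpace ℝ d)‖ * ‖q.2 - (Yk i).2‖ := abs_real_inner_le_norm _ _
        _ = ‖q.2 - (Yk i).2‖ := by rw [norm_eq_of_mem_sphere q.1, one_mul]
        _ ≤ ‖q.2‖ + ‖(Yk i).2‖ := norm_sub_le _ _
        _ ≤ (1 + ‖(Yk i).2‖) * (1 + ‖q.2‖) := by nlinarith [norm_nonneg q.2, norm_nonneg (Yk i).2]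
    rw [abs_le] at hin
    simp only [ha, hb]
    constructor
    · rw [abs_of_nonneg (le_max_right _ _)]; exact max_le hin.2 (by positivity)
    · rw [abs_of_nonneg (le_max_right _ _)]; exact max_le (by linarith [hin.1]) (by positivity)
  have hE : ∀ (Zm : Config m' d (UnitAddTorus d)) (q : sphere (0 : EuclideanSpace ℝ d) 1 × EuclideanSpace ℝ d),
      |fden (lossConfig (Torus.geometry d) ε (Fin.append Yk Zm) (Fin.castAdd m' i) q.1 q.2)| ≤
        CW * Real.exp (-β * configEnergy Yk) * Real.exp (-β * configEnergy Zm) * Real.exp (-(β / 2) * ‖q.2‖ ^ 2) ∧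
      |fden (gainConfig (Torus.geometry d) ε (Fin.append Yk Zm) (Fin.castAdd m' i) q.1 q.2)| ≤
        CW * Real.exp (-β * configEnergy Yk) * Real.exp (-β * configEnergy Zm) * Real.exp (-(β / 2) * ‖q.2‖ ^ 2) := by
    intro Zm q
    have hexp : CW * Real.exp (-β * (configEnergy (Fin.append Yk Zm) + 2⁻¹ * ‖q.2‖ ^ 2)) =
        CW * Real.exp (-β * configEnergy Yk) * Real.exp (-β * configEnergy Zm) * Real.exp (-(β / 2) * ‖q.2‖ ^ 2) := by
      rw [configEnergy_append, mul_assoc, mul_assoc, ← Real.exp_add, ← Real.exp_add]; congr 2; ring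
    constructor
    · have h := hfden_b (lossConfig (Torus.geometry d) ε (Fin.append Yk Zm) (Fin.castAdd m' i) q.1 q.2)
      rwa [configEnergy_lossConfig, hexp] at h
    · have h := hfden_b (gainConfig (Torus.geometry d) ε (Fin.append Yk Zm) (Fin.castAdd m' i) q.1 q.2)
      rwa [configEnergy_gainConfig, hexp] at h
  have hΦ_le : ∀ (Zm : Config m' d (UnitAddTorus d)) (q : sphere (0 : EuclideanSpace ℝ d) 1 × EuclideanSpace ℝ d),
      |Φ Zm q| ≤ 2 * CW * (1 + ‖(Yk i).2‖) * Real.exp (-β * configEnergy Yk) *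
        (Real.exp (-β * configEnergy Zm) * ((1 + ‖q.2‖) * Real.exp (-(β / 2) * ‖q.2‖ ^ 2))) := by
    intro Zm q
    obtain ⟨h1, h2⟩ := hab_le q
    obtain ⟨h3, h4⟩ := hE Zm q
    simp only [hΦ]
    have hA : |a q * fden (lossConfig (Torus.geometry d) ε (Fin.append Yk Zm) (Fin.castAdd m' i) q.1 q.2)| ≤
        ((1 + ‖(Yk i).2‖) * (1 + ‖q.2‖)) * (CW * Real.exp (-β * configEnergy Yk) * Real.exp (-β * configEnergy Zm) * Real.exp (-(β / 2) * ‖q.2‖ ^ 2)) := by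
      rw [abs_mul]; exact mul_le_mul h1 h3 (abs_nonneg _) (by positivity)
    have hB : |b q * fden (gainConfig (Torus.geometry d) ε (Fin.append Yk Zm) (Fin.castAdd m' i) q.1 q.2)| ≤
        ((1 + ‖(Yk i).2‖) * (1 + ‖q.2‖)) * (CW * Real.exp (-β * configEnergy Yk) * Real.exp (-β * configEnergy Zm) * Real.exp (-(β / 2) * ‖q.2‖ ^ 2)) := by
      rw [abs_mul]; exact mul_le_mul h2 h4 (abs_nonneg _) (by positivity)
    calc _ ≤ |a q * fden (lossConfig (Torus.geometry d) ε (Fin.append Yk Zm) (Fin.castAdd m' i) q.1 q.2)| +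
          |b q * fden (gainConfig (Torus.geometry d) ε (Fin.append Yk Zm) (Fin.castAdd m' i) q.1 q.2)| := abs_sub _ _
      _ ≤ _ := by nlinarith [hA, hB]
  -- measurability of `Φ` on the product
  have hΦm : Measurable (fun r : Config m' d (UnitAddTorus d) × (sphere (0 : EuclideanSpace ℝ d) 1 × EuclideanSpace ℝ d) => Φ r.1 r.2) := by
    have hZm : Measurable fun r : Config m' d (UnitAddTorus d) × (sphere (0 : EuclideanSpace ℝ d) 1 × EuclideanSpace ℝ d) =>
        (Fin.append Yk r.1 : Config (k + m') d (UnitAddTorus d)) := by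
      refine measurable_pi_lambda _ fun j => ?_
      refine Fin.addCases (fun j₁ => ?_) (fun j₂ => ?_) j
      · simp only [Fin.append_left]; exact measurable_const
      · simp only [Fin.append_right]; exact (measurable_pi_apply j₂).comp measurable_fst
    have hω : Measurable fun r : Config m' d (UnitAddTorus d) × (sphere (0 : EuclideanSpace ℝ d) 1 × EuclideanSpace ℝ d) =>
        (r.2.1 : EuclideanSpace ℝ d) := continuous_subtype_val.measurable.comp measurable_snd.fst
    have hv : Measurable fun r : Config m' d (UnitAddTorus d) × (sphere (0 : EuclideanSpace ℝ d) 1 × EuclideanSpace ℝ d) => r.2.2 :=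
      measurable_snd.snd
    have hin : Measurable fun r : Config m' d (UnitAddTorus d) × (sphere (0 : EuclideanSpace ℝ d) 1 × EuclideanSpace ℝ d) =>
        ⟪(r.2.1 : EuclideanSpace ℝ d), r.2.2 - (Yk i).2⟫_ℝ := hω.inner (hv.sub measurable_const)
    have hloss := measurable_lossConfig hGm.measurable_translate ε (Fin.castAdd m' i) hZm hω hv
    have hgain := measurable_gainConfig hGm.measurable_translate ε (Fin.castAdd m' i) hZm hω hv
    have h1 : Measurable fun r : Config m' d (UnitAddTorus d) × (sphere (0 : EuclideanSpace ℝ d) 1 × EuclideanSpace ℝ d) =>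
        max ⟪(r.2.1 : EuclideanSpace ℝ d), r.2.2 - (Yk i).2⟫_ℝ 0 *
          fden (lossConfig (Torus.geometry d) ε (Fin.append Yk r.1) (Fin.castAdd m' i) r.2.1 r.2.2) :=
      (hin.max measurable_const).mul (hfden_m.comp hloss)
    have h2 : Measurable fun r : Config m' d (UnitAddTorus d) × (sphere (0 : EuclideanSpace ℝ d) 1 × EuclideanSpace ℝ d) =>
        max (-⟪(r.2.1 : EuclideanSpace ℝ d), r.2.2 - (Yk i).2⟫_ℝ) 0 *
          fden (gainConfig (Torus.geometry d) ε (Fin.append Yk r.1) (Fin.castAdd m' i) r.2.1 r.2.2) :=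
      (hin.neg.max measurable_const).mul (hfden_m.comp hgain)
    simp only [hΦ, ha, hb]
    exact h1.sub h2
  -- integrability on the product
  have hΦi : Integrable (fun r : Config m' d (UnitAddTorus d) × (sphere (0 : EuclideanSpace ℝ d) 1 × EuclideanSpace ℝ d) => Φ r.1 r.2)
      ((volume : Measure (Config m' d (UnitAddTorus d))).prod
      ((((volume : Measure (EuclideanSpace ℝ d)).toSphere)).prod (volume : Measure (EuclideanSpace ℝ d)))) := by
    have h1 := integrable_exp_neg_mul_configEnergy (d := d) (n := m') hβ
    have h2 : Integrable (fun q : sphere (0 : EuclideanSpace ℝ d) 1 × EuclideanSpace ℝ d => (1 + ‖q.2‖) * Real.exp (-(β / 2) * ‖q.2‖ ^ 2))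
        ((((volume : Measure (EuclideanSpace ℝ d)).toSphere)).prod (volume : Measure (EuclideanSpace ℝ d))) := by
      have hg := Literature.Analysis.FluidPDE.integrable_one_add_norm_mul_exp (E := EuclideanSpace ℝ d) hβ
      have := (integrable_const (μ := ((volume : Measure (EuclideanSpace ℝ d)).toSphere)) (1 : ℝ)).mul_prod hg
      simpa using this
    have h12 := (h1.mul_prod h2).const_mul (2 * CW * (1 + ‖(Yk i).2‖) * Real.exp (-β * configEnergy Yk))
    refine h12.mono' hΦm.aestronglyMeasurable (Filter.Eventually.of_forall fun r => ?_)
    rw [Real.norm_eq_abs]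
    exact hΦ_le r.1 r.2
  -- Fubini
  have hinner : ∀ Zm : Config m' d (UnitAddTorus d), ∫ ω, (∫ v, Φ Zm (ω, v)) ∂((volume : Measure (EuclideanSpace ℝ d)).toSphere) =
      ∫ q, Φ Zm q ∂((((volume : Measure (EuclideanSpace ℝ d)).toSphere)).prod (volume : Measure (EuclideanSpace ℝ d))) := by
    intro Zm
    have hΦZi : Integrable (Φ Zm) ((((volume : Measure (EuclideanSpace ℝ d)).toSphere)).prod (volume : Measure (EuclideanSpace ℝ d))) := by
      have h2 : Integrable (fun q : sphere (0 : EuclideanSpace ℝ d) 1 × EuclideanSpace ℝ d => (1 + ‖q.2‖) * Real.exp (-(β / 2) * ‖q.2‖ ^ 2))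
          ((((volume : Measure (EuclideanSpace ℝ d)).toSphere)).prod (volume : Measure (EuclideanSpace ℝ d))) := by
        have hg := Literature.Analysis.FluidPDE.integrable_one_add_norm_mul_exp (E := EuclideanSpace ℝ d) hβ
        have := (integrable_const (μ := ((volume : Measure (EuclideanSpace ℝ d)).toSphere)) (1 : ℝ)).mul_prod hg
        simpa using this
      have h12 := h2.const_mul (2 * CW * (1 + ‖(Yk i).2‖) * Real.exp (-β * configEnergy Yk) * Real.exp (-β * configEnergy Zm))
      refine h12.mono' (hΦm.comp (measurable_const.prodMk measurable_id)).aestronglyMeasurable (Filter.Eventually.of_forall fun q => ?_)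
      rw [Real.norm_eq_abs]
      have := hΦ_le Zm q
      calc _ ≤ _ := this
        _ = _ := by ring
    rw [integral_prod _ hΦZi]
  simp_rw [hinner]
  have hP1 : ∫ Zm : Config m' d (UnitAddTorus d), ∫ q, Φ Zm q ∂((((volume : Measure (EuclideanSpace ℝ d)).toSphere)).prod (volume : Measure (EuclideanSpace ℝ d))) =
      ∫ r, Φ r.1 r.2 ∂((volume : Measure (Config m' d (UnitAddTorus d))).prod
        ((((volume : Measure (EuclideanSpace ℝ d)).toSphere)).prod (volume : Measure (EuclideanSpace ℝ d)))) :=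
    (integral_prod (fun r : Config m' d (UnitAddTorus d) × (sphere (0 : EuclideanSpace ℝ d) 1 × EuclideanSpace ℝ d) => Φ r.1 r.2) hΦi).symm
  rw [hP1, integral_prod_symm _ hΦi]
  -- now `∫ q, ∫ Zm, Φ Zm q`, and `q ↦ ∫ Zm, Φ Zm q` splits as `∫ ω, ∫ v`
  have hswap : Integrable (fun r : (sphere (0 : EuclideanSpace ℝ d) 1 × EuclideanSpace ℝ d) × Config m' d (UnitAddTorus d) => Φ r.2 r.1)
      (((((volume : Measure (EuclideanSpace ℝ d)).toSphere)).prod (volume : Measure (EuclideanSpace ℝ d))).prod volume) := hΦi.swap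
  have hq : Integrable (fun q : sphere (0 : EuclideanSpace ℝ d) 1 × EuclideanSpace ℝ d => ∫ Zm : Config m' d (UnitAddTorus d), Φ Zm q)
      ((((volume : Measure (EuclideanSpace ℝ d)).toSphere)).prod (volume : Measure (EuclideanSpace ℝ d))) := hswap.integral_prod_left
  rw [integral_prod _ hq]
  simp only [hsCollisionTerm, sphereMeasure, Function.comp_apply]
  refine integral_congr_ae (Filter.Eventually.of_forall fun ω => ?_)
  refine integral_congr_ae (Filter.Eventually.of_forall fun v => ?_)
  -- the `Zm`-integral of `Φ` at fixed `(ω, v)`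
  have hli : Integrable fun Zm : Config m' d (UnitAddTorus d) => fden (lossConfig (Torus.geometry d) ε (Fin.append Yk Zm) (Fin.castAdd m' i) ω v) := by
    have h1 := (integrable_exp_neg_mul_configEnergy (d := d) (n := m') hβ).const_mul (CW * Real.exp (-β * configEnergy Yk) * Real.exp (-(β / 2) * ‖v‖ ^ 2))
    refine h1.mono' ?_ (Filter.Eventually.of_forall fun Zm => ?_)
    · exact ((hfden_m.comp (measurable_lossConfig hGm.measurable_translate ε (Fin.castAdd m' i)
        (measurable_pi_lambda _ fun j => by
          refine Fin.addCases (fun j₁ => ?_) (fun j₂ => ?_) j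
          · simp only [Fin.append_left]; exact measurable_const
          · simp only [Fin.append_right]; exact measurable_pi_apply j₂) measurable_const measurable_const))).aestronglyMeasurable
    · rw [Real.norm_eq_abs]
      calc _ ≤ _ := (hE Zm (ω, v)).1
        _ = _ := by ring
  have hgi : Integrable fun Zm : Config m' d (UnitAddTorus d) => fden (gainConfig (Torus.geometry d) ε (Fin.append Yk Zm) (Fin.castAdd m' i) ω v) := by
    have h1 := (integrable_exp_neg_mul_configEnergy (d := d) (n := m') hβ).const_mul (CW * Real.exp (-β * configEnergy Yk) * Real.exp (-(β / 2) * ‖v‖ ^ 2))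
    refine h1.mono' ?_ (Filter.Eventually.of_forall fun Zm => ?_)
    · exact ((hfden_m.comp (measurable_gainConfig hGm.measurable_translate ε (Fin.castAdd m' i)
        (measurable_pi_lambda _ fun j => by
          refine Fin.addCases (fun j₁ => ?_) (fun j₂ => ?_) j
          · simp only [Fin.append_left]; exact measurable_const
          · simp only [Fin.append_right]; exact measurable_pi_apply j₂) measurable_const measurable_const))).aestronglyMeasurable
    · rw [Real.norm_eq_abs]
      calc _ ≤ _ := (hE Zm (ω, v)).2
        _ = _ := by ring
  simp only [hΦ, ha, hb]
  rw [integral_sub (hli.const_mul _) (hgi.const_mul _), integral_const_mul, integral_const_mul, hloss_marg, hgain_marg,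
    outRep_gainConfig_torus hε hε', outRep_lossConfig_torus hε hε']

end Marginal

end Kinetic

end

end Literature.MathematicalPhysics.KineticTheory
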